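import Mathlib
import HarnessLib
import Literature.NumberTheory.LFunctions.GeneralizedRH

/-!
# RiemannHypothesis / RuelleBand — the weak-norm term of a Lasota–Yorke realisation is not idle

Route `RiemannHypothesis/RuelleBand`, crux item stmt-RiemannHypothesis-2063
(`AsymptoticCriticalLine`), line `interior-edge-split`, helper file (`--supports`). Everything is
proved; no definitions.

The Lasota–Yorke / Hennion engine of the line reads the crux ("for every `ε > 0` only finitely
many zeros of `ζ` in the open strip have `|Re ρ − 1/2| ≥ ε`") off a realisation: a complex Hilbert
space `H`, a family `T : ℝ → (H →L[ℂ] H)`, a time `t₀ > 0`, a two-norm inequality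
`‖(T t₀)ⁿ f‖ ≤ C_ε e^{n ε t₀} ‖f‖ + R_{n,ε} · w(f)` for every `ε > 0` with a weak seminorm `w`, and
a one-sided joint eigenvector `T t v = e^{t(ρ − 1/2)} v` (`t ≥ 0`) at every zero `ρ` of `ζ` in the
open critical strip. This file records that the weak-norm term `R · w(f)` carries ALL the slack
("finitely many exceptions") of the crux: with `w = 0` the inequality is the spectral-radius bound
`‖(T t₀)ⁿ‖ ≤ C_ε e^{n ε t₀}` for every `ε > 0` (i.e. `r(T t₀) ≤ 1`), and then EVERY zero of the
open strip lies on the critical line (`re_eq_half_of_spectralRadiusRealisation`) — such a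
realisation is exactly as strong as the Riemann Hypothesis in strip form (in particular it gives
the top rung `ExactFirstBand` of the route by `Or.inl`).

**Proof.** A joint eigenvector `v ≠ 0` at `ρ` is an eigenvector of `(T t₀)ⁿ` for `μⁿ`,
`μ := e^{t₀(ρ − 1/2)}` (`ContinuousLinearMap.pow_apply_eq_pow_smul`), so
`‖μ‖ⁿ ‖v‖ = ‖(T t₀)ⁿ v‖ ≤ ‖(T t₀)ⁿ‖ ‖v‖ ≤ C_ε e^{n ε t₀} ‖v‖`. With
`‖μ‖ = e^{t₀ (Re ρ − 1/2)}` and, if `Re ρ > 1/2`, the choice `ε := (Re ρ − 1/2)/2`, this reads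
`e^{n t₀ ε} ≤ C_ε` for all `n`, which is absurd (`e^x ≥ 1 + x`, Archimedes); hence `Re ρ ≤ 1/2`
(`re_le_half_of_spectralRadiusRealisation`). Applied to `ρ` and to the reflected zero `1 − ρ` of
the open strip (functional equation; tree lemma
`Literature.NumberTheory.LFunctions.GeneralizedRH.riemannZeta_one_sub_eq_zero`, from Mathlib
`riemannZeta_one_sub`) it gives `Re ρ ≤ 1/2` and `1 − Re ρ ≤ 1/2`, i.e. `Re ρ = 1/2`.

References: H. Hennion, Proc. Amer. Math. Soc. 118 (1993) 627–634 (the two-norm inequality and the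
essential spectral radius); E. C. Titchmarsh, *The Theory of the Riemann Zeta-function* (1986),
§2.12 (the reflection `ρ ↦ 1 − ρ`).
-/

noncomputable section

-- D-0017: `Summit.<S>.<S>.…` is the designed namespace of a single-problem summit.
set_option linter.dupNamespace false

namespace Summit.RiemannHypothesis.RiemannHypothesis.Theorems

variable {H : Type*} [NormedAddCommGroup H] [NormedSpace ℂ H]

/-- An eigenvector of a bounded operator `A` for `μ` is an eigenvector of `A ^ n` for `μ ^ n`.
[folklore] -/
theorem ContinuousLinearMap.pow_apply_eq_pow_smul (A : H →L[ℂ] H) {μ : ℂ} {v : H}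
    (hv : A v = μ • v) (n : ℕ) : (A ^ n) v = μ ^ n • v := by
  induction n with
  | zero => simp
  | succ n ih =>
    rw [pow_succ, mul_apply_eq_comp, hv, map_smul, ih, smul_smul, ← pow_succ']

/-- **The spectral-radius bound forces `Re ρ ≤ 1/2`.** If `t₀ > 0`,
`‖(T t₀)ⁿ‖ ≤ C_ε e^{n ε t₀}` for every `ε > 0` and all `n`, and `T t₀ v = e^{t₀(s − 1/2)} v` for
some `v ≠ 0`, then `Re s ≤ 1/2`: otherwise, with `δ := Re s − 1/2 > 0` and `ε := δ/2`,
`e^{n t₀ δ} ‖v‖ = ‖(T t₀)ⁿ v‖ ≤ C e^{n t₀ δ/2} ‖v‖`, i.e. `1 + n t₀ δ/2 ≤ e^{n t₀ δ/2} ≤ C` for all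
`n`, contradicting Archimedes. [folklore] -/
theorem re_le_half_of_spectralRadiusRealisation (T : ℝ → H →L[ℂ] H) {t₀ : ℝ} (ht₀ : 0 < t₀)
    (hLY : ∀ ε : ℝ, 0 < ε → ∃ C : ℝ, ∀ n : ℕ, ‖T t₀ ^ n‖ ≤ C * Real.exp ((n : ℝ) * ε * t₀))
    {s : ℂ} {v : H} (hv : v ≠ 0) (hT : T t₀ v = Complex.exp (↑t₀ * (s - 1 / 2)) • v) :
    s.re ≤ 1 / 2 := by
  refine le_of_not_gt fun hlt => ?_
  obtain ⟨δ, hδ, hδs⟩ : ∃ δ : ℝ, 0 < δ ∧ s.re - 1 / 2 = δ := ⟨s.re - 1 / 2, by linarith, rfl⟩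
  obtain ⟨C, hC⟩ := hLY (δ / 2) (by positivity)
  have hμ : ‖Complex.exp (↑t₀ * (s - 1 / 2))‖ = Real.exp (t₀ * δ) := by
    rw [Complex.norm_exp, Complex.re_ofReal_mul, ← hδs]
    norm_num
  have hv' : 0 < ‖v‖ := norm_pos_iff.mpr hv
  -- `e^{n t₀ δ / 2} ≤ C` for all `n`
  have key : ∀ n : ℕ, Real.exp ((n : ℝ) * (t₀ * δ / 2)) ≤ C := by
    intro n
    have h1 : ‖(T t₀ ^ n) v‖ ≤ C * Real.exp ((n : ℝ) * (δ / 2) * t₀) * ‖v‖ :=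
      ((T t₀ ^ n).le_opNorm v).trans (mul_le_mul_of_nonneg_right (hC n) (norm_nonneg _))
    rw [ContinuousLinearMap.pow_apply_eq_pow_smul (T t₀) hT n, norm_smul, norm_pow, hμ,
      ← Real.exp_nat_mul] at h1
    have h2 : Real.exp ((n : ℝ) * (t₀ * δ)) ≤ C * Real.exp ((n : ℝ) * (δ / 2) * t₀) :=
      le_of_mul_le_mul_right h1 hv'
    have h3 : Real.exp ((n : ℝ) * (t₀ * δ))
        = Real.exp ((n : ℝ) * (t₀ * δ / 2)) * Real.exp ((n : ℝ) * (δ / 2) * t₀) := by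
      rw [← Real.exp_add]
      congr 1
      ring
    rw [h3] at h2
    exact le_of_mul_le_mul_right h2 (Real.exp_pos _)
  -- Archimedes
  have hc : 0 < t₀ * δ / 2 := by positivity
  obtain ⟨n, hn⟩ := exists_nat_gt (C / (t₀ * δ / 2))
  have hn' : C < (n : ℝ) * (t₀ * δ / 2) := (div_lt_iff₀ hc).mp hn
  have := (Real.add_one_le_exp ((n : ℝ) * (t₀ * δ / 2))).trans (key n)
  linarith

/-- **`w = 0` in a Lasota–Yorke realisation forces RH in the strip.** If a family
`T : ℝ → (H →L[ℂ] H)` on a complex Hilbert space satisfies the spectral-radius bound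
`‖(T t₀)ⁿ‖ ≤ C_ε e^{n ε t₀}` (`t₀ > 0`, every `ε > 0`, all `n`) and realises every zero `ρ` of
`ζ` in the open critical strip as a one-sided joint eigenvalue, `T t v = e^{t(ρ − 1/2)} v` for
`t ≥ 0` with `v ≠ 0`, then every such zero has `Re ρ = 1/2`: `Re ρ ≤ 1/2` by
`re_le_half_of_spectralRadiusRealisation` at time `t₀`, and `1 − Re ρ ≤ 1/2` by the same at the
reflected zero `1 − ρ` (`GeneralizedRH.riemannZeta_one_sub_eq_zero`). So the weak-norm term
`R · w(f)` of the two-norm inequality is where all the slack of `AsymptoticCriticalLine` lives.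
[folklore] -/
theorem re_eq_half_of_spectralRadiusRealisation :
    ∀ (H : Type) (_ : NormedAddCommGroup H) (_ : InnerProductSpace ℂ H) (_ : CompleteSpace H) (T : ℝ → H →L[ℂ] H) (t₀ : ℝ), 0 < t₀ → (∀ ε : ℝ, 0 < ε → ∃ C : ℝ, ∀ n : ℕ, ‖T t₀ ^ n‖ ≤ C * Real.exp ((n : ℝ) * ε * t₀)) → (∀ s : ℂ, riemannZeta s = 0 → 0 < s.re → s.re < 1 → ∃ v : H, v ≠ 0 ∧ ∀ t : ℝ, 0 ≤ t → T t v = Complex.exp (↑t * (s - 1 / 2)) • v) → ∀ s : ℂ, riemannZeta s = 0 → 0 < s.re → s.re < 1 → s.re = 1 / 2 := by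
  intro H _ _ _ T t₀ ht₀ hLY heig s hs h0 h1
  have key : ∀ z : ℂ, riemannZeta z = 0 → 0 < z.re → z.re < 1 → z.re ≤ 1 / 2 := by
    intro z hz hz0 hz1
    obtain ⟨v, hv, hTv⟩ := heig z hz hz0 hz1
    exact re_le_half_of_spectralRadiusRealisation T ht₀ hLY hv (hTv t₀ ht₀.le)
  have hrefl := key (1 - s)
    (Literature.NumberTheory.LFunctions.GeneralizedRH.riemannZeta_one_sub_eq_zero hs h0 h1)
    (by rw [Complex.sub_re, Complex.one_re]; linarith)
    (by rw [Complex.sub_re, Complex.one_re]; linarith)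
  rw [Complex.sub_re, Complex.one_re] at hrefl
  exact le_antisymm (key s hs h0 h1) (by linarith)

end Summit.RiemannHypothesis.RiemannHypothesis.Theorems

end
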